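import Summits.BirchSwinnertonDyer.BirchSwinnertonDyer.Theorems.KimAtThreeDeepUpperSupplyLedger
import HarnessLib

/-!
# Route `KimAtThreeKolyvagin` (rung W2), crux `DeepUpperAtThree`: the two ledgers WITH A LOCAL LATTICE
# INDEX — the dictionary value law `p^{e₁} · Λ(loc z) = u · p^{e₂} · δ̃` (Kodaira IV / IV* at `p = 3`:
# `e₁ = v₃(c₃) = 1`, `e₂ = t`)

Cell `bsd-addord`, seat `bsd-addord-w2-c3` (D-0074 row B6), item `stmt-BirchSwinnertonDyer-19076`.
The landed ledgers `KimAtThreeDeepUpperLedger` (upper bound with the index at `∅`) and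
`KimAtThreeDeepUpperSupplyLedger` (supply at a good core vertex) take the dictionary value in the shape
of cell n1011's port, `Λ(loc z) = u · p^t · δ̃` (Kim AJM 148 Thm. 3.13's `p^t`-formula, whose
derivation uses Lemma 3.10 / Rem. 3.8: "`exp*_ω(H¹(ℚ_p,T)) = p^{−t}ℤ_p`", i.e. `p ∤ [E(ℚ_p):E₀(ℚ_p)]`).
At `p = 3` that lemma is FALSE on the Kodaira IV / IV* rows (`c₃ = 3`): the local lattice is
`exp*_ω(H¹(ℚ₃,T)) = 3^{v₃(c₃)−t}ℤ₃` (cell memo `kim3/KIM3-PROOF.md` §4.2 Lemma L, §4.3 Prop. D: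
`3^{v₃(c₃)} · x_n ≡ U · δ̃_n`), so the value law there reads `3^{v₃(c₃)} · Λ(loc z_n) = u · 3^t · δ̃_n`
— a law with TWO exponents. This file re-proves both ledgers for the general two-exponent law
`p^{e₁} · Λ(loc z) = u · p^{e₂} · δ` (`e₁ = 0`, `e₂ = t` recovers the landed ones), so that the
Kato-side chain of crux 19076 covers the IV / IV* rows the seat fragment singles out («the lattice
index `3^{v₃(c₃)−t}` of Kim 2026 Rem 3.8 is FALSE there — handle it»):

* `LatticeIndex.natCard_selmerGroup_kummer_dvd_pow_of_stub_of_kato₂` — at the empty level: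
  `p^{e₁} · Λ(loc κ_∅) = u · p^{e₂} · δ̃₁`, `δ̃₁ = p^v · unit`, `e₂ + v < K`, Kato `κ′_∅ = (p^α b) • g`,
  the count and the STUB decomposition of `g` ⟹ `e₁ + α ≤ e₂ + v` and
  `#Sel_{p^K}(E/ℚ) ∣ p^{e₂ + v − e₁ − α}`;
* `LatticeIndex.exists_eq_pow_mul_unit_of_goodCoreVertex₂` — at a good core vertex:
  `p^{e₁} · L z = u · p^{e₂} · δ`, `z = (p^α b) • g`, `L` injective on `H ∋ g` of order `p^K`,
  `e₁ + α < K` ⟹ `e₂ ≤ e₁ + α` and `δ = p^{e₁ + α − e₂} · unit` (`not_pow_dvd_of_goodCoreVertex₂`: a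
  certificate of depth `e₁ + α − e₂ + 1`);
* `LatticeIndex.certificateDepth_of_upperLedger₂` — the two exponents cancel in the sum:
  `ord_p δ̃_n + ord_p #Sel_{p^K} ≤ v`, i.e. the supplied certificate has exactly the depth crux 19076
  asks for, on IV/IV* rows as on the others (the lattice index shifts `∂⁽⁰⁾` and `∂^{(∞)}_{deep}` by the
  SAME amount — the memo's "harmless, absorbed in the normalisation exponent `e(Ω)`", now in the kernel).

Pure algebra / witness currency as in the two parent files; TOOL theorems; nothing asserted about any
curve. [cite: Kim2022StructureSelmer, Thm. 3.13, Lemma 3.10, Rem. 3.8, Lemma 3.14]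
[cite: Kato2004Asterisque, Prop. 14.21 and 14.22 (pp. 248–249)] [cite: Rubin2011, Thm. 2.8.4 (p. 25)]
[cite: BlochKato1990, Prop. 3.8 (p. 354)] [cite: Kim2025RefinedTNC, §4.2, Prop. 4.2]
-/

set_option autoImplicit false
-- the Theorems namespace of a single-conjunct summit repeats the summit name by design (D-0017)
set_option linter.dupNamespace false

noncomputable section

open scoped Classical NumberField
open NumberField IsDedekindDomain WeierstrassCurve
  Literature.NumberTheory.EllipticCurves
  Literature.NumberTheory.GaloisRepresentations
  Literature.NumberTheory.GaloisRepresentations.DiscreteGaloisModule Literature.NumberTheory.GaloisCohomology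

namespace Summit.BirchSwinnertonDyer.BirchSwinnertonDyer.Theorems.KimAtThreeDeepUpperLedgerLatticeIndex

open Summit.BirchSwinnertonDyer.Rank1Residual.GaloisImage
open Summit.BirchSwinnertonDyer.BirchSwinnertonDyer.Theorems
open KimAtThreeDeepUpperLedger KimAtThreeDeepUpperSupplyLedger

namespace LatticeIndex

/-! ## §1 Algebra: the two-exponent visibility in `ℤ/p^K` -/

section Algebra

variable {p : ℕ} [hp : Fact p.Prime]

/-- In `ℤ/p^K`: from `p^{e₁} · ((p^α b) · y) = u · p^{e₂} · (p^v · w₀)` with `p ∤ b`, `u, w₀` units and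
`e₂ + v < K`: `e₁ + α ≤ e₂ + v` and `y = p^{e₂+v−e₁−α} · (unit)`. [folklore] -/
theorem exists_eq_pow_mul_unit_of_twoExponent {K e₁ e₂ α b v : ℕ} (hK : e₂ + v < K) (hb : ¬ p ∣ b)
    (y : ZMod (p ^ K)) (u w₀ : (ZMod (p ^ K))ˣ)
    (h : ((p ^ e₁ : ℕ) : ZMod (p ^ K)) * (((p ^ α * b : ℕ) : ZMod (p ^ K)) * y) =
      (u : ZMod (p ^ K)) * ((p ^ e₂ : ℕ) : ZMod (p ^ K)) *
        (((p ^ v : ℕ) : ZMod (p ^ K)) * (w₀ : ZMod (p ^ K)))) :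
    e₁ + α ≤ e₂ + v ∧
      ∃ w' : (ZMod (p ^ K))ˣ, y = ((p ^ (e₂ + v - (e₁ + α)) : ℕ) : ZMod (p ^ K)) * (w' : ZMod (p ^ K)) := by
  -- normalise to `(p^{e₁+α} b) · y = p^{e₂+v} · (u w₀)`
  have h' : ((p ^ (e₁ + α) * b : ℕ) : ZMod (p ^ K)) * y =
      ((p ^ (e₂ + v) : ℕ) : ZMod (p ^ K)) * ((u * w₀ : (ZMod (p ^ K))ˣ) : ZMod (p ^ K)) := by
    rw [Units.val_mul]
    push_cast at h ⊢
    linear_combination h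
  have hle : e₁ + α ≤ e₂ + v := by
    by_contra hlt
    rw [not_le] at hlt
    have hdvd : ((p ^ (e₂ + v + 1) : ℕ) : ZMod (p ^ K)) ∣
        ((p ^ (e₂ + v) : ℕ) : ZMod (p ^ K)) * ((u * w₀ : (ZMod (p ^ K))ˣ) : ZMod (p ^ K)) := by
      rw [← h']
      exact (Nat.cast_dvd_cast ((Nat.pow_dvd_pow p hlt).mul_right b)).mul_right y
    have := DeepLedgerUpper.le_of_pow_dvd_pow_mul_unit (p := p) (by omega) (u * w₀) hdvd
    omega
  exact ⟨hle, Ledger.exists_eq_pow_mul_unit_of_natCast_mul_eq (p := p) hK hle hb y (u * w₀) h'⟩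

end Algebra

/-! ## §2 The upper ledger with a lattice index (empty level) -/

section Upper

variable (W : WeierstrassCurve ℚ) [W.IsElliptic] (p : ℕ) [hp : Fact p.Prime] (k : ℕ)

/-- **Upper bound with the index, two-exponent value law.** Data at the deep level `K = k + 1` as in
`DeepLedgerUpper.natCard_selmerGroup_kummer_dvd_pow_of_stub_of_kato`, except that the empty-level
dictionary value reads `p^{e₁} · Λ(loc κ_∅) = u · p^{e₂} · δ̃₁` (`e₁` = the local lattice index,
`v₃(c₃)` on Kodaira IV/IV* rows at `p = 3`; `e₂ = t`), `δ̃₁ = p^v · unit`, `e₂ + v < K`. With Kato's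
class `κ′_∅ = (p^α b) • g`, the count `#H¹_{𝓕_can} = p^K · p^{n₀}` and the STUB decomposition
`g = p^{n₀} • e + m` (`e ∈ H¹_{𝓕_can}`, `m ∈ Sel_{p^K}`): `e₁ + α ≤ e₂ + v` and
`#Sel_{p^K}(E/ℚ) ∣ p^{e₂ + v − (e₁ + α)}`. [cite: Kim2022StructureSelmer, Thm. 3.13, Lemma 3.10 and Rem. 3.8]
[cite: Rubin2011, Thm. 2.8.4 (p. 25)] -/
theorem natCard_selmerGroup_kummer_dvd_pow_of_stub_of_kato₂ (hp2 : p ≠ 2)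
    {v₀ : HeightOneSpectrum (𝓞 ℚ)} (hv₀ : ((p : ℕ) : 𝓞 ℚ) ∈ v₀.asIdeal)
    (Λ : galoisCohomology ((W.torsionGaloisModule ((p : ℤ) ^ k * (p : ℤ))).toLocal (Sum.inr v₀)) 1
      →+ ZMod (p ^ (k + 1)))
    (hker : ∀ x ∈ propagatedSelmerStructure W p k (Sum.inr v₀),
      Λ x = 0 ↔ x ∈ W.kummerSelmerStructure ((p : ℤ) ^ k * (p : ℤ)) (Sum.inr v₀))
    {κ₀ κ₀' g e m : galoisCohomology (W.torsionGaloisModule ((p : ℤ) ^ k * (p : ℤ))) 1}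
    (hbr₀ : κ₀' = κ₀) {e₁ e₂ v : ℕ} (hK : e₂ + v < k + 1) (u w₀ : (ZMod (p ^ (k + 1)))ˣ)
    {δ₁ : ZMod (p ^ (k + 1))} (hδ₁ : δ₁ = ((p ^ v : ℕ) : ZMod (p ^ (k + 1))) * (w₀ : ZMod _))
    (hdict₀ : ((p ^ e₁ : ℕ) : ZMod (p ^ (k + 1))) * Λ (galoisCohomology.localization _ (Sum.inr v₀) 1 κ₀) =
      (u : ZMod (p ^ (k + 1))) * ((p ^ e₂ : ℕ) : ZMod (p ^ (k + 1))) * δ₁)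
    {α b : ℕ} (hb : ¬ p ∣ b) (ha' : κ₀' = (p ^ α * b) • g)
    {n₀ : ℕ}
    (hcount : Nat.card (propagatedSelmerStructure W p k).selmerGroup = p ^ (k + 1) * p ^ n₀)
    (he : e ∈ (propagatedSelmerStructure W p k).selmerGroup)
    (hm : m ∈ (W.kummerSelmerStructure ((p : ℤ) ^ k * (p : ℤ))).selmerGroup)
    (hstub : g = p ^ n₀ • e + m) :
    e₁ + α ≤ e₂ + v ∧
      Nat.card (W.kummerSelmerStructure ((p : ℤ) ^ k * (p : ℤ))).selmerGroup ∣
        p ^ (e₂ + v - (e₁ + α)) := by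
  haveI : NeZero (p ^ (k + 1)) := ⟨pow_ne_zero _ hp.out.ne_zero⟩
  -- `p^{e₁} · ((p^α b) · Λ(loc g)) = u · p^{e₂} · (p^v w₀)`
  have hval : ((p ^ e₁ : ℕ) : ZMod (p ^ (k + 1))) *
      (((p ^ α * b : ℕ) : ZMod (p ^ (k + 1))) * Λ (galoisCohomology.localization _ (Sum.inr v₀) 1 g)) =
      (u : ZMod (p ^ (k + 1))) * ((p ^ e₂ : ℕ) : ZMod (p ^ (k + 1))) *
        (((p ^ v : ℕ) : ZMod (p ^ (k + 1))) * (w₀ : ZMod _)) := by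
    rw [← nsmul_eq_mul (p ^ α * b : ℕ), ← map_nsmul, ← map_nsmul, ← ha', hbr₀, ← hδ₁]
    exact hdict₀
  obtain ⟨hle, w', hw'⟩ := exists_eq_pow_mul_unit_of_twoExponent (p := p) hK hb _ u w₀ hval
  exact ⟨hle, DeepLedgerUpper.natCard_selmerGroup_kummer_dvd_pow_of_stub W p k hp2 hv₀ Λ hker hcount
    he hm hstub (β := e₂ + v - (e₁ + α)) (by omega) w' hw'⟩

end Upper

/-! ## §3 The supply ledger with a lattice index (good core vertex) -/

section Supply

variable {p : ℕ} [hp : Fact p.Prime]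

/-- **Supply at a good core vertex, two-exponent value law.** `L` (`= Λ_n ∘ loc_p`) injective on
`H ∋ g` with `g` of order `p^K`, Kato's class `z = (p^α b) • g` (`p ∤ b`, `e₁ + α < K`), and the value
`p^{e₁} · L z = u · p^{e₂} · δ`. Then `e₂ ≤ e₁ + α` and `δ = p^{e₁ + α − e₂} · (unit)`: on a Kodaira
IV/IV* row at `p = 3` (`e₁ = 1`, `e₂ = t = 0`) the Kurihara number at the vertex has `ord₃ = α + 1`
— never a unit (the cell's P1 law "`3 ∣ c₃` ⇒ no unit Kurihara number"), but a certificate of depth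
`α + 2`. [cite: Kim2022StructureSelmer, Thm. 3.13, Lemma 3.10 and Rem. 3.8, Lemma 3.14] -/
theorem exists_eq_pow_mul_unit_of_goodCoreVertex₂ {G : Type*} [AddCommGroup G] {K : ℕ}
    (L : G →+ ZMod (p ^ K)) (H : AddSubgroup G) (hinj : ∀ x ∈ H, L x = 0 → x = 0)
    {g : G} (hg : g ∈ H) (hord : addOrderOf g = p ^ K)
    {z : G} {α b e₁ e₂ : ℕ} (hb : ¬ p ∣ b) (hK : e₁ + α < K) (hz : z = (p ^ α * b) • g)
    (u : (ZMod (p ^ K))ˣ) {δ : ZMod (p ^ K)}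
    (hdict : ((p ^ e₁ : ℕ) : ZMod (p ^ K)) * L z =
      (u : ZMod (p ^ K)) * ((p ^ e₂ : ℕ) : ZMod (p ^ K)) * δ) :
    e₂ ≤ e₁ + α ∧
      ∃ w : (ZMod (p ^ K))ˣ, δ = ((p ^ (e₁ + α - e₂) : ℕ) : ZMod (p ^ K)) * (w : ZMod (p ^ K)) := by
  haveI : NeZero (p ^ K) := ⟨pow_ne_zero K hp.out.ne_zero⟩
  obtain ⟨wg, hwg⟩ := SupplyLedger.isUnit_apply_of_injOn_of_addOrderOf_eq L H hinj hg hord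
  have hbcop : Nat.Coprime b (p ^ K) :=
    Nat.Coprime.pow_right K ((Nat.Prime.coprime_iff_not_dvd hp.out).2 hb).symm
  set ub : (ZMod (p ^ K))ˣ := ZMod.unitOfCoprime b hbcop with hub
  have hubval : (ub : ZMod (p ^ K)) = (b : ZMod (p ^ K)) := ZMod.coe_unitOfCoprime b hbcop
  -- `p^{e₂} · (u δ) = p^{e₁+α} · (b wg)`
  have hval : ((p ^ e₂ : ℕ) : ZMod (p ^ K)) * ((u : ZMod (p ^ K)) * δ) =
      ((p ^ (e₁ + α) : ℕ) : ZMod (p ^ K)) * ((ub * wg : (ZMod (p ^ K))ˣ) : ZMod (p ^ K)) := by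
    have h1 : L z = ((p ^ α * b : ℕ) : ZMod (p ^ K)) * (wg : ZMod (p ^ K)) := by
      rw [hz, map_nsmul, nsmul_eq_mul, hwg]
    rw [h1] at hdict
    rw [Units.val_mul, hubval]
    push_cast at hdict ⊢
    linear_combination -hdict
  obtain ⟨hle, w', hw'⟩ :=
    DeepLedgerUpper.exists_eq_pow_sub_mul_unit (p := p) hK _ (ub * wg) hval
  refine ⟨hle, u⁻¹ * w', ?_⟩
  calc δ = ((u⁻¹ : (ZMod (p ^ K))ˣ) : ZMod (p ^ K)) * ((u : ZMod (p ^ K)) * δ) := by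
          rw [← mul_assoc, Units.inv_mul, one_mul]
    _ = ((p ^ (e₁ + α - e₂) : ℕ) : ZMod (p ^ K)) * ((u⁻¹ * w' : (ZMod (p ^ K))ˣ) : ZMod (p ^ K)) := by
          rw [hw', Units.val_mul]; ring

/-- **The certificate at the vertex, two-exponent law**: `δ ∉ (p^{e₁+α−e₂+1})`.
[cite: Kim2022StructureSelmer, Thm. 1.9 (6) and §1.5.1] -/
theorem not_pow_dvd_of_goodCoreVertex₂ {G : Type*} [AddCommGroup G] {K : ℕ}
    (L : G →+ ZMod (p ^ K)) (H : AddSubgroup G) (hinj : ∀ x ∈ H, L x = 0 → x = 0)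
    {g : G} (hg : g ∈ H) (hord : addOrderOf g = p ^ K)
    {z : G} {α b e₁ e₂ : ℕ} (hb : ¬ p ∣ b) (hK : e₁ + α < K) (hz : z = (p ^ α * b) • g)
    (u : (ZMod (p ^ K))ˣ) {δ : ZMod (p ^ K)}
    (hdict : ((p ^ e₁ : ℕ) : ZMod (p ^ K)) * L z =
      (u : ZMod (p ^ K)) * ((p ^ e₂ : ℕ) : ZMod (p ^ K)) * δ) :
    ¬ ((p ^ (e₁ + α - e₂ + 1) : ℕ) : ZMod (p ^ K)) ∣ δ := by
  obtain ⟨hle, w, hw⟩ := exists_eq_pow_mul_unit_of_goodCoreVertex₂ L H hinj hg hord hb hK hz u hdict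
  rw [hw]
  intro hdvd
  have := DeepLedgerUpper.le_of_pow_dvd_pow_mul_unit (p := p) (by omega) w hdvd
  omega

end Supply

/-! ## §4 The exponents cancel: the supplied depth is the one crux 19076 asks for -/

/-- **Depth bookkeeping, two-exponent law.** With `#Sel_{p^K} = p^s`, the upper ledger's
`s ≤ e₂ + v − (e₁ + α)` and the vertex certificate of exact valuation `γ = e₁ + α − e₂`
(`e₂ ≤ e₁ + α ≤ e₂ + v`): `γ + s ≤ v`, i.e. `γ ≤ v − s` — the certificate depth `γ + 1` is at most
`∂⁽⁰⁾ − ord_p #Ш(p) + 1`, on the IV/IV* rows exactly as elsewhere (the lattice index `e₁` cancels).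
Arithmetic only; feeds `KimAtThreeDeepUpperSupplyGlue.deepUpper_conclusion_of_supplyWitnesses`.
[cite: Kim2025RefinedTNC, Thm 1.1] [cite: Kim2022StructureSelmer, Lemma 3.14] -/
theorem certificateDepth_of_upperLedger₂ {s v e₁ e₂ α : ℕ} (hs : s ≤ e₂ + v - (e₁ + α))
    (h₁ : e₂ ≤ e₁ + α) (h₂ : e₁ + α ≤ e₂ + v) : e₁ + α - e₂ ≤ v - s ∧ s ≤ v := by
  omega

end LatticeIndex

end Summit.BirchSwinnertonDyer.BirchSwinnertonDyer.Theorems.KimAtThreeDeepUpperLedgerLatticeIndex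

end
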